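import Summits.QuantumFields.BalabanUV.Beta.FP.LegRemainderGaugeTerm
import Summits.QuantumFields.BalabanUV.Beta.FP.PerfectFFBlockRowSum
import Summits.QuantumFields.BalabanUV.Beta.FP.SliceProjectorKernelDiff
import Summits.QuantumFields.BalabanUV.Beta.FP.PerfectPropagatorKernelLegs

/-!
# `BalabanUV.Beta.FP.GaugeTermRoadLegs` — road «FP» (binder row D1), lane IR-5′, **THE (R1) GAUGE TERM AT THE ROAD's THREE LEGS:
# RHOA-3's `hR0` AND `hR1` ARE UNCONDITIONAL** — the generic three-leg engine `FP/LegRemainderGaugeTerm` (`abs_rho_le`, `abs_rho_sub_left_le`)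
# INSTANTIATED at the free gradient leg `F_μ z = ½(G₀(z+e_μ) − G₀ z)` (cubic letter ✓ `BlockAveragedKernelLegs.letterDiff_free`), the coarse leg
# `S_ν x q = Re[(1−Π)_n(x, q+e_ν) − (1−Π)_n(x, q)]` (letters ✓ `SliceProjectorKernelDiff.norm_piC_sub_left_le_fine` ∕ `_sub_sub_le_fine`,
# `s₀ ≍ n⁻⁵`, `s₁ ≍ n⁻⁶`) and the long leg `Γ_m = ` the ff block of `KPerf … m` ((T0′) ✓ `PerfectFFBlockRowSum.exists_sum_abs_KPerf_ff_le_col`,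
# `T₀ = A₀·n²`), `n = Lc^m`: `|ρ| ≤ B₀∕n²`, `|ρ(p+e_i,·) − ρ(p,·)| ≤ B₁∕n³` with ONE `B₀, B₁` for all `m ≥ 1` (odd `Lc > 1`)

HONEST DEPENDENCY (page 1, mandatory): continuum YM on T⁴ ⇐ BetaPertH ∧ nine spine estimates (0/9 proved); BetaPertH ⇐ (D1) ∧ (D4) ∧
CAP+tail; G-an2-4 gates asym, D1 and NE2/3/4.  HONEST FRAMING (cell contract, verbatim): «discharging `BetaPertH` makes Bałaban's UV
stability UNCONDITIONAL — a real constructive-QFT result; it is NOT the continuum limit and NOT the Clay problem.»  THIS MODULE is bookkeeping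
BY NAME over four kernel theorems of the tree (the engine `LegRemainderGaugeTerm` g18, the Γ-letter (T0′) `PerfectFFBlockRowSum` g19, the
`(1−Π)_N` difference letters `SliceProjectorKernelDiff` (leaf-06 g9), the free leg's cubic letter `BlockAveragedKernelLegs` (gan24-leaf-04 g39)) and the
sup-norm bridge `PerfectPropagatorKernelLegs.supNorm_cast_eq`; it cites nothing, mints no `def … : Prop`, declares no data `def`, 0 sorry.
WHAT IT IS NOT: the identification of the END's leg remainder `R m` with the (R1) sum `−D·G₀·(1−Π)·Dᵀ·Γ + P·Qᵀ·𝓘ᴸ` at the perfect family is the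
OWNER's located conjecture R-γ-18 (ii) (this file fixes ONE orientation of `D` and the real part of `(1−Π)_n`; the other orientations have the
same letters); the column letters `hR1′`∕`hR2` need (T1′) (NOT proved: conditional on a second (1.115) entry for the VECTOR `G`); NOT the constraint
term `P·Qᵀ·𝓘ᴸ`; NOT hslice, NOT (ASYMP), NOT D1, NOT BetaPertH, NOT continuum, NOT Clay.

ABSOLUTE RULE (cell charter, verbatim): «No internally-minted statement may enter as a cited fact. Every hypothesis is either kernel-proved in this
package or a verbatim quotation of a PUBLISHED theorem with page reference. The manuscript(s) under audit are NOT citable for their own disputed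
steps — they are the thing under adjudication; programme-internal (2001/route/tribunal) claims are never citable.»

CONTENT (`Pt = ℤ⁴`, `‖·‖∞ = DyadicShell.supNorm`; `n ≥ 1`; road: `d = 3`, odd `Lc > 1`, `n = Lc^m`, `m ≥ 1`).
* §1 THE LEG LETTERS in the engine's hypothesis shapes: the free leg's cubic letter is `BlockAveragedKernelLegs.letterDiff_free` BY NAME
  (`|F_μ z| ≤ A_F∕(‖z‖∞+1)³`, `A_F = 8(2U₀+2c₄+Bgrad₀)`); the coarse leg's `letter_S0` ∕ `letter_S1` (`|S_ν n x q| ≤ s₀(n)·e^{−(κ_Y∕n)‖x−q‖∞}`, `|S_ν n (x+e_i) q − S_ν n x q| ≤ s₁(n)·e^{…}`, `s₀(n) = CS·e^{κ_Y}·n⁻⁴·(33∕n)`,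
  `s₁(n) = CS·e^{κ_Y}·n⁻⁴·(33∕n)²`), and (T0′) is read BY NAME.
* §2 THE TWO RHOA-3 LETTERS at fixed `n` and fixed Γ-letter `T₀`: `abs_rho_road_le`, `abs_rho_road_sub_left_le`.
* §3 POWER COUNT, m-UNIFORM: `window_le` (`1 + 80n∕κ ≤ (1 + 80∕κ)·n`), **`exists_abs_rho_road_le`** (`∃ B₀ ∀ m ≥ 1 ∀ μ ν l p w, |ρ| ≤ B₀∕((Lc)^m)²`),
  **`exists_abs_rho_road_sub_left_le`** (`∃ B₁ ∀ m ≥ 1 ∀ μ ν l i p w, |ρ(p+e_i) − ρ p| ≤ B₁∕((Lc)^m)³`), and the `ν`-summed gauge-term kernel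
  `exists_abs_sum_rho_road_le` ∕ `exists_abs_sum_rho_road_sub_left_le` (four directions, constants ×4).
Unit `b2b-balaban-beta-d1-formalise-leaf-05` (gen 20; D1 formalisation swarm leaf seat, road FP lane IR-5′), 2026-08-21; `LEAVES-FP.md` row
«(R1) GAUGE TERM AT THE ROAD's LEGS».  «not in print; our bookkeeping».
-/

noncomputable section

namespace Summit.QuantumFields.BalabanUV.Beta.FP.GaugeTermRoadLegs

open Finset Real
open scoped BigOperators
open Literature.MathematicalPhysics.QuantumFieldTheory.Balaban1983to89
open Literature.MathematicalPhysics.QuantumFieldTheory.Balaban1983to89.Beta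
open Literature.MathematicalPhysics.QuantumFieldTheory.Balaban1983to89.Beta.DyadicShell (Pt supNorm supNorm_eq_zero_iff)
open Literature.MathematicalPhysics.QuantumFieldTheory.Balaban1983to89.Beta.BubbleTransfer (c4 c4_pos)
open Literature.MathematicalPhysics.QuantumFieldTheory.Balaban1983to89.Beta.TwoPowerLegs (free)
open Literature.MathematicalPhysics.QuantumFieldTheory.Balaban1983to89.Beta.AffineAveraging (unitVec)
open Literature.Probability.LatticeModels (latticeGreen)
open Summit.QuantumFields.BalabanUV.Beta.GAN24.CombesThomas (sfStep smStep)
open Summit.QuantumFields.BalabanUV.Beta.FP.PerfectObjectsT (KPerf)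
open Summit.QuantumFields.BalabanUV.Beta.FP.SliceProjectorKernel (piC)
open Summit.QuantumFields.BalabanUV.Beta.FP.SliceProjectorMidInv (kapY kapY_pos)
open Summit.QuantumFields.BalabanUV.Beta.FP.SliceProjectorAliasSum (CS cN_pos)
open Summit.QuantumFields.BalabanUV.Beta.FP.SliceProjectorKernelDiff (norm_piC_sub_left_le_fine norm_piC_sub_sub_le_fine)
open Summit.QuantumFields.BalabanUV.Beta.FP.BlockAveragedKernelLegs (letterDiff_free)
open Summit.QuantumFields.BalabanUV.Beta.FP.PerfectPropagatorKernelLegs (supNorm_cast_eq)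
open Summit.QuantumFields.BalabanUV.Beta.FP.PerfectFFBlockRowSum (exists_sum_abs_KPerf_ff_le_col)
open Summit.QuantumFields.BalabanUV.Beta.FP.LegRemainderGaugeTerm (abs_rho_le abs_rho_sub_left_le nonneg_of_cubic)

/-! ## §1 The three leg letters -/

/- THE FREE GRADIENT LEG's CUBIC LETTER is READ BY NAME (no restatement — `dedup.landed`): `F_μ z := ½(latticeGreen (z + e_μ) − latticeGreen z)`
(= `[D G₀]((p,μ), x)` as a function of `z = p − x` for the forward gradient `(Df)(p,μ) = f(p+e_μ) − f(p)` and `G₀ = G0ker = ½latticeGreen`, by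
evenness) satisfies `|F_μ z| ≤ A_F∕(‖z‖∞+1)³` on all of `ℤ⁴`, `A_F = 8(2U₀ + 2c₄ + Bgrad₀)` — this IS `BlockAveragedKernelLegs.letterDiff_free μ z`. -/

/-- [our bookkeeping] **THE COARSE LEG's ZEROTH LETTER** in the engine's shape: for `S_ν n x q := Re(piC n x (q+e_ν) − piC n x q)` (the `(q,ν)` column of
`(1−Π)_n·Dᵀ`, real part), `|S_ν n x q| ≤ s₀(n)·e^{−(κ_Y∕n)‖x−q‖∞}` with `s₀(n) = CS(3)·e^{κ_Y}·n⁻⁴·(33∕n)`, `κ_Y = kapY 4` —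
`SliceProjectorKernelDiff.norm_piC_sub_left_le_fine` + `|Re z| ≤ ‖z‖` + the sup-norm bridge. -/
theorem letter_S0 (n : ℕ) [NeZero n] (ν : Fin 4) (x q : Pt) :
    |(piC (d := 3) n x (q + unitVec ν) - piC (d := 3) n x q).re|
      ≤ (CS 3 * Real.exp (kapY (3 + 1)) * ((n : ℝ) ^ (3 + 1))⁻¹ * (33 / n)) * Real.exp (-(kapY (3 + 1) / n) * (supNorm (x - q) : ℝ)) := by
  have h := norm_piC_sub_left_le_fine (d := 3) n x q ν
  rw [← supNorm_cast_eq (x - q)] at h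
  exact (Complex.abs_re_le_norm _).trans h

/-- [our bookkeeping] **THE COARSE LEG's FIRST-DIFFERENCE LETTER** (one unit step `e_i` in the row variable):
`|S_ν n (x+e_i) q − S_ν n x q| ≤ s₁(n)·e^{−(κ_Y∕n)‖x−q‖∞}`, `s₁(n) = CS(3)·e^{κ_Y}·n⁻⁴·(33∕n)²` — piC's MIXED letter `norm_piC_sub_sub_le_fine`. -/
theorem letter_S1 (n : ℕ) [NeZero n] (ν i : Fin 4) (x q : Pt) :
    |(piC (d := 3) n (x + unitVec i) (q + unitVec ν) - piC (d := 3) n (x + unitVec i) q).re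
        - (piC (d := 3) n x (q + unitVec ν) - piC (d := 3) n x q).re|
      ≤ (CS 3 * Real.exp (kapY (3 + 1)) * ((n : ℝ) ^ (3 + 1))⁻¹ * (33 / n) ^ 2) * Real.exp (-(kapY (3 + 1) / n) * (supNorm (x - q) : ℝ)) := by
  have h := norm_piC_sub_sub_le_fine (d := 3) n x q i ν
  rw [← supNorm_cast_eq (x - q)] at h
  rw [← Complex.sub_re]
  refine (Complex.abs_re_le_norm _).trans ?_
  have e : piC (d := 3) n (x + unitVec i) (q + unitVec ν) - piC (d := 3) n (x + unitVec i) q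
      - (piC (d := 3) n x (q + unitVec ν) - piC (d := 3) n x q)
      = piC (d := 3) n (x + unitVec i) (q + unitVec ν) - piC (d := 3) n (x + unitVec i) q
        - piC (d := 3) n x (q + unitVec ν) + piC (d := 3) n x q := by ring
  rw [e]; exact h

/-! ## §2 The two RHOA-3 letters of the gauge term at fixed blocking `n` and fixed Γ-letter `T₀` -/

section Fixed

variable {n : ℕ} [NeZero n] {Γ : Pt → Pt → ℝ} {T₀ : ℝ}

/-- [our object] **`hR0` AT THE ROAD's LEGS, FIXED `n`**: for `ρ p w := Σ'_{(x,q)} F_μ(p−x)·S_ν n x q·Γ q w` with any long leg `Γ` carrying the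
column-ℓ¹ letter `Σ_{q∈Q}|Γ q w| ≤ T₀`: `|ρ p w| ≤ 2A_F·(1 + 80n∕κ_Y)·s₀(n)·T₀`. -/
theorem abs_rho_road_le (hn : 1 ≤ n) (hT0 : ∀ (w : Pt) (Q : Finset Pt), ∑ q ∈ Q, |Γ q w| ≤ T₀) (μ ν : Fin 4) (p w : Pt) :
    |∑' xq : Pt × Pt, (latticeGreen (p - xq.1 + Pi.single μ 1) / 2 - latticeGreen (p - xq.1) / 2)
        * (piC (d := 3) n xq.1 (xq.2 + unitVec ν) - piC (d := 3) n xq.1 xq.2).re * Γ xq.2 w|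
      ≤ 2 * (8 * (2 * free.U + 2 * c4 + free.Bgrad)) * (1 + 80 * n / kapY (3 + 1))
          * (CS 3 * Real.exp (kapY (3 + 1)) * ((n : ℝ) ^ (3 + 1))⁻¹ * (33 / n)) * T₀ :=
  abs_rho_le (F := fun z => latticeGreen (z + Pi.single μ 1) / 2 - latticeGreen z / 2)
    (S := fun x q => (piC (d := 3) n x (q + unitVec ν) - piC (d := 3) n x q).re) (G := Γ)
    (kapY_pos (3 + 1)) hn (letterDiff_free μ) (letter_S0 n ν) hT0 p w

/-- [our object] **`hR1` AT THE ROAD's LEGS, FIXED `n`**: one unit step `e_i` in the row variable lands on the coarse leg —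
`|ρ (p+e_i) w − ρ p w| ≤ 2A_F·(1 + 80n∕κ_Y)·s₁(n)·T₀`. -/
theorem abs_rho_road_sub_left_le (hn : 1 ≤ n) (hT0 : ∀ (w : Pt) (Q : Finset Pt), ∑ q ∈ Q, |Γ q w| ≤ T₀) (μ ν i : Fin 4) (p w : Pt) :
    |(∑' xq : Pt × Pt, (latticeGreen (p + unitVec i - xq.1 + Pi.single μ 1) / 2 - latticeGreen (p + unitVec i - xq.1) / 2)
          * (piC (d := 3) n xq.1 (xq.2 + unitVec ν) - piC (d := 3) n xq.1 xq.2).re * Γ xq.2 w)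
        - ∑' xq : Pt × Pt, (latticeGreen (p - xq.1 + Pi.single μ 1) / 2 - latticeGreen (p - xq.1) / 2)
          * (piC (d := 3) n xq.1 (xq.2 + unitVec ν) - piC (d := 3) n xq.1 xq.2).re * Γ xq.2 w|
      ≤ 2 * (8 * (2 * free.U + 2 * c4 + free.Bgrad)) * (1 + 80 * n / kapY (3 + 1))
          * (CS 3 * Real.exp (kapY (3 + 1)) * ((n : ℝ) ^ (3 + 1))⁻¹ * (33 / n) ^ 2) * T₀ :=
  abs_rho_sub_left_le (F := fun z => latticeGreen (z + Pi.single μ 1) / 2 - latticeGreen z / 2)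
    (S := fun x q => (piC (d := 3) n x (q + unitVec ν) - piC (d := 3) n x q).re) (G := Γ)
    (kapY_pos (3 + 1)) hn (letterDiff_free μ) (letter_S0 n ν) (unitVec i) (letter_S1 n ν i) hT0 p w

end Fixed

/-! ## §3 The power count, uniform in `m`: `B₀∕n²` and `B₁∕n³` at `n = Lc^m` -/

/-- [folklore] the window constant is linear in `n`: `1 + 80n∕κ ≤ (1 + 80∕κ)·n` for `n ≥ 1`, `κ > 0`. -/
theorem window_le {κ : ℝ} (hκ : 0 < κ) {n : ℕ} (hn : 1 ≤ n) : 1 + 80 * (n : ℝ) / κ ≤ (1 + 80 / κ) * n := by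
  have hn' : (1 : ℝ) ≤ n := by exact_mod_cast hn
  have h80 : 0 ≤ 80 / κ := by positivity
  have e : (1 + 80 / κ) * (n : ℝ) = n + 80 * (n : ℝ) / κ := by ring
  rw [e]; linarith

/-- [folklore] `0 ≤ CS 3·e^{κ_Y}` (the coarse leg's amplitude constant). -/
theorem CS_exp_nonneg : 0 ≤ CS 3 * Real.exp (kapY (3 + 1)) := by
  have := cN_pos 3
  unfold CS; positivity

/-- [folklore] THE ZEROTH PRODUCT OF CONSTANTS: `(1 + 80n∕κ)·(c·n⁻⁴·(33∕n))·(A₀·n²) ≤ (1+80∕κ)·c·33·|A₀|·n⁻²` for `n ≥ 1` (`c ≥ 0`). -/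
theorem prod_zero_le {κ c A₀ : ℝ} (hκ : 0 < κ) (hc : 0 ≤ c) {n : ℕ} (hn : 1 ≤ n) :
    (1 + 80 * (n : ℝ) / κ) * (c * ((n : ℝ) ^ (3 + 1))⁻¹ * (33 / n)) * (A₀ * (n : ℝ) ^ 2)
      ≤ (1 + 80 / κ) * c * 33 * |A₀| / (n : ℝ) ^ 2 := by
  have hn0 : (0 : ℝ) < n := by exact_mod_cast hn
  have hw := window_le hκ hn
  have hA : A₀ ≤ |A₀| := le_abs_self A₀
  have hκ' : 0 ≤ 1 + 80 / κ := by positivity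
  calc (1 + 80 * (n : ℝ) / κ) * (c * ((n : ℝ) ^ (3 + 1))⁻¹ * (33 / n)) * (A₀ * (n : ℝ) ^ 2)
      = (1 + 80 * (n : ℝ) / κ) * A₀ * (c * 33 / (n : ℝ) ^ 3) := by field_simp; ring
    _ ≤ ((1 + 80 / κ) * n) * |A₀| * (c * 33 / (n : ℝ) ^ 3) := by
        have h3 : 0 ≤ c * 33 / (n : ℝ) ^ 3 := by positivity
        have h1 : (1 + 80 * (n : ℝ) / κ) * A₀ ≤ ((1 + 80 / κ) * n) * |A₀| := by
          have hw0 : 0 ≤ 1 + 80 * (n : ℝ) / κ := by positivity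
          calc (1 + 80 * (n : ℝ) / κ) * A₀ ≤ (1 + 80 * (n : ℝ) / κ) * |A₀| := mul_le_mul_of_nonneg_left hA hw0
            _ ≤ ((1 + 80 / κ) * n) * |A₀| := mul_le_mul_of_nonneg_right hw (abs_nonneg _)
        exact mul_le_mul_of_nonneg_right h1 h3
    _ = (1 + 80 / κ) * c * 33 * |A₀| / (n : ℝ) ^ 2 := by field_simp

/-- [folklore] THE FIRST PRODUCT OF CONSTANTS: `(1 + 80n∕κ)·(c·n⁻⁴·(33∕n)²)·(A₀·n²) ≤ (1+80∕κ)·c·33²·|A₀|·n⁻³` for `n ≥ 1` (`c ≥ 0`). -/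
theorem prod_one_le {κ c A₀ : ℝ} (hκ : 0 < κ) (hc : 0 ≤ c) {n : ℕ} (hn : 1 ≤ n) :
    (1 + 80 * (n : ℝ) / κ) * (c * ((n : ℝ) ^ (3 + 1))⁻¹ * (33 / n) ^ 2) * (A₀ * (n : ℝ) ^ 2)
      ≤ (1 + 80 / κ) * c * 33 ^ 2 * |A₀| / (n : ℝ) ^ 3 := by
  have hn0 : (0 : ℝ) < n := by exact_mod_cast hn
  have hw := window_le hκ hn
  have hA : A₀ ≤ |A₀| := le_abs_self A₀
  have hκ' : 0 ≤ 1 + 80 / κ := by positivity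
  calc (1 + 80 * (n : ℝ) / κ) * (c * ((n : ℝ) ^ (3 + 1))⁻¹ * (33 / n) ^ 2) * (A₀ * (n : ℝ) ^ 2)
      = (1 + 80 * (n : ℝ) / κ) * A₀ * (c * 33 ^ 2 / (n : ℝ) ^ 4) := by field_simp; ring
    _ ≤ ((1 + 80 / κ) * n) * |A₀| * (c * 33 ^ 2 / (n : ℝ) ^ 4) := by
        have h3 : 0 ≤ c * 33 ^ 2 / (n : ℝ) ^ 4 := by positivity
        have h1 : (1 + 80 * (n : ℝ) / κ) * A₀ ≤ ((1 + 80 / κ) * n) * |A₀| := by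
          have hw0 : 0 ≤ 1 + 80 * (n : ℝ) / κ := by positivity
          calc (1 + 80 * (n : ℝ) / κ) * A₀ ≤ (1 + 80 * (n : ℝ) / κ) * |A₀| := mul_le_mul_of_nonneg_left hA hw0
            _ ≤ ((1 + 80 / κ) * n) * |A₀| := mul_le_mul_of_nonneg_right hw (abs_nonneg _)
        exact mul_le_mul_of_nonneg_right h1 h3
    _ = (1 + 80 / κ) * c * 33 ^ 2 * |A₀| / (n : ℝ) ^ 3 := by field_simp

section Road

variable {Lc : ℕ} [NeZero Lc]

omit [NeZero Lc] in
/-- [folklore] `1 ≤ Lc^m` for `Lc > 1`. -/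
theorem one_le_pow_of_one_lt (hLc : 1 < Lc) (m : ℕ) : 1 ≤ Lc ^ m := Nat.one_le_pow m Lc (by omega)

/-- [our object] **`hR0` OF THE (R1) GAUGE TERM, m-UNIFORM**: for `d = 3`, odd `Lc > 1`, there is ONE `B₀` with, for every `m ≥ 1`, every
`μ ν l : Fin 4` and all `p w ∈ ℤ⁴`,
`|Σ'_{(x,q)} F_μ(p−x)·S_ν (Lc^m) x q·KPerf … m q w (inl ν) (inl l)| ≤ B₀ ∕ ((Lc)^m)²`
— RHOA-3's `hR0 : |R u w| ≤ B∕n²` for the gauge term, UNCONDITIONAL (engine + three kernel leg letters; (T0′) BY NAME). -/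
theorem exists_abs_rho_road_le (hLc : Odd Lc ∧ 1 < Lc) :
    ∃ B₀ : ℝ, ∀ m : ℕ, 1 ≤ m → ∀ (μ ν l : Fin 4) (p w : Pt),
      |∑' xq : Pt × Pt, (latticeGreen (p - xq.1 + Pi.single μ 1) / 2 - latticeGreen (p - xq.1) / 2)
          * (piC (d := 3) (Lc ^ m) xq.1 (xq.2 + unitVec ν) - piC (d := 3) (Lc ^ m) xq.1 xq.2).re
          * KPerf (d := 3) Lc (sfStep Lc) (smStep 3 Lc) m xq.2 w (Sum.inl ν) (Sum.inl l)|
        ≤ B₀ / ((Lc : ℝ) ^ m) ^ 2 := by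
  obtain ⟨A₀, hA₀⟩ := exists_sum_abs_KPerf_ff_le_col (Lc := Lc) hLc
  have hκ := kapY_pos (3 + 1)
  refine ⟨2 * (8 * (2 * free.U + 2 * c4 + free.Bgrad)) * ((1 + 80 / kapY (3 + 1)) * (CS 3 * Real.exp (kapY (3 + 1))) * 33 * |A₀|),
    fun m hm μ ν l p w => ?_⟩
  have hn : 1 ≤ Lc ^ m := one_le_pow_of_one_lt hLc.2 m
  haveI : NeZero (Lc ^ m) := ⟨pow_ne_zero m (NeZero.ne Lc)⟩
  have hcast : ((Lc ^ m : ℕ) : ℝ) = (Lc : ℝ) ^ m := by push_cast; ring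
  have hT0 : ∀ (w : Pt) (Q : Finset Pt),
      ∑ q ∈ Q, |KPerf (d := 3) Lc (sfStep Lc) (smStep 3 Lc) m q w (Sum.inl ν) (Sum.inl l)| ≤ A₀ * (((Lc ^ m : ℕ) : ℝ)) ^ 2 := by
    intro w Q; rw [hcast]; exact hA₀ m hm w ν l Q
  have h := abs_rho_road_le (n := Lc ^ m) (Γ := fun q w => KPerf (d := 3) Lc (sfStep Lc) (smStep 3 Lc) m q w (Sum.inl ν) (Sum.inl l))
    hn hT0 μ ν p w
  refine h.trans ?_
  have hAF : 0 ≤ 2 * (8 * (2 * free.U + 2 * c4 + free.Bgrad)) := by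
    have h0 : 0 ≤ 8 * (2 * free.U + 2 * c4 + free.Bgrad) := nonneg_of_cubic (letterDiff_free μ)
    linarith
  have hp := prod_zero_le (A₀ := A₀) hκ CS_exp_nonneg hn
  rw [hcast] at hp
  calc 2 * (8 * (2 * free.U + 2 * c4 + free.Bgrad)) * (1 + 80 * ((Lc ^ m : ℕ) : ℝ) / kapY (3 + 1))
        * (CS 3 * Real.exp (kapY (3 + 1)) * (((Lc ^ m : ℕ) : ℝ) ^ (3 + 1))⁻¹ * (33 / ((Lc ^ m : ℕ) : ℝ))) * (A₀ * (((Lc ^ m : ℕ) : ℝ)) ^ 2)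
      = 2 * (8 * (2 * free.U + 2 * c4 + free.Bgrad)) * ((1 + 80 * ((Lc ^ m : ℕ) : ℝ) / kapY (3 + 1))
        * (CS 3 * Real.exp (kapY (3 + 1)) * (((Lc ^ m : ℕ) : ℝ) ^ (3 + 1))⁻¹ * (33 / ((Lc ^ m : ℕ) : ℝ))) * (A₀ * (((Lc ^ m : ℕ) : ℝ)) ^ 2)) := by
          ring
    _ ≤ 2 * (8 * (2 * free.U + 2 * c4 + free.Bgrad)) * ((1 + 80 / kapY (3 + 1)) * (CS 3 * Real.exp (kapY (3 + 1))) * 33 * |A₀| / ((Lc : ℝ) ^ m) ^ 2) := by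
          rw [hcast]; exact mul_le_mul_of_nonneg_left hp hAF
    _ = _ := by ring

/-- [our object] **`hR1` OF THE (R1) GAUGE TERM, m-UNIFORM**: one `B₁` with, for every `m ≥ 1`, `μ ν l i`, `p w`,
`|ρ (p+e_i) w − ρ p w| ≤ B₁ ∕ ((Lc)^m)³` — RHOA-3's `hR1 : |R (u+e_i) w − R u w| ≤ B∕n³` for the gauge term, UNCONDITIONAL. -/
theorem exists_abs_rho_road_sub_left_le (hLc : Odd Lc ∧ 1 < Lc) :
    ∃ B₁ : ℝ, ∀ m : ℕ, 1 ≤ m → ∀ (μ ν l i : Fin 4) (p w : Pt),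
      |(∑' xq : Pt × Pt, (latticeGreen (p + unitVec i - xq.1 + Pi.single μ 1) / 2 - latticeGreen (p + unitVec i - xq.1) / 2)
            * (piC (d := 3) (Lc ^ m) xq.1 (xq.2 + unitVec ν) - piC (d := 3) (Lc ^ m) xq.1 xq.2).re
            * KPerf (d := 3) Lc (sfStep Lc) (smStep 3 Lc) m xq.2 w (Sum.inl ν) (Sum.inl l))
          - ∑' xq : Pt × Pt, (latticeGreen (p - xq.1 + Pi.single μ 1) / 2 - latticeGreen (p - xq.1) / 2)
            * (piC (d := 3) (Lc ^ m) xq.1 (xq.2 + unitVec ν) - piC (d := 3) (Lc ^ m) xq.1 xq.2).re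
            * KPerf (d := 3) Lc (sfStep Lc) (smStep 3 Lc) m xq.2 w (Sum.inl ν) (Sum.inl l)|
        ≤ B₁ / ((Lc : ℝ) ^ m) ^ 3 := by
  obtain ⟨A₀, hA₀⟩ := exists_sum_abs_KPerf_ff_le_col (Lc := Lc) hLc
  have hκ := kapY_pos (3 + 1)
  refine ⟨2 * (8 * (2 * free.U + 2 * c4 + free.Bgrad)) * ((1 + 80 / kapY (3 + 1)) * (CS 3 * Real.exp (kapY (3 + 1))) * 33 ^ 2 * |A₀|),
    fun m hm μ ν l i p w => ?_⟩
  have hn : 1 ≤ Lc ^ m := one_le_pow_of_one_lt hLc.2 m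
  haveI : NeZero (Lc ^ m) := ⟨pow_ne_zero m (NeZero.ne Lc)⟩
  have hcast : ((Lc ^ m : ℕ) : ℝ) = (Lc : ℝ) ^ m := by push_cast; ring
  have hT0 : ∀ (w : Pt) (Q : Finset Pt),
      ∑ q ∈ Q, |KPerf (d := 3) Lc (sfStep Lc) (smStep 3 Lc) m q w (Sum.inl ν) (Sum.inl l)| ≤ A₀ * (((Lc ^ m : ℕ) : ℝ)) ^ 2 := by
    intro w Q; rw [hcast]; exact hA₀ m hm w ν l Q
  have h := abs_rho_road_sub_left_le (n := Lc ^ m)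
    (Γ := fun q w => KPerf (d := 3) Lc (sfStep Lc) (smStep 3 Lc) m q w (Sum.inl ν) (Sum.inl l)) hn hT0 μ ν i p w
  refine h.trans ?_
  have hAF : 0 ≤ 2 * (8 * (2 * free.U + 2 * c4 + free.Bgrad)) := by
    have h0 : 0 ≤ 8 * (2 * free.U + 2 * c4 + free.Bgrad) := nonneg_of_cubic (letterDiff_free μ)
    linarith
  have hp := prod_one_le (A₀ := A₀) hκ CS_exp_nonneg hn
  rw [hcast] at hp
  calc 2 * (8 * (2 * free.U + 2 * c4 + free.Bgrad)) * (1 + 80 * ((Lc ^ m : ℕ) : ℝ) / kapY (3 + 1))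
        * (CS 3 * Real.exp (kapY (3 + 1)) * (((Lc ^ m : ℕ) : ℝ) ^ (3 + 1))⁻¹ * (33 / ((Lc ^ m : ℕ) : ℝ)) ^ 2) * (A₀ * (((Lc ^ m : ℕ) : ℝ)) ^ 2)
      = 2 * (8 * (2 * free.U + 2 * c4 + free.Bgrad)) * ((1 + 80 * ((Lc ^ m : ℕ) : ℝ) / kapY (3 + 1))
        * (CS 3 * Real.exp (kapY (3 + 1)) * (((Lc ^ m : ℕ) : ℝ) ^ (3 + 1))⁻¹ * (33 / ((Lc ^ m : ℕ) : ℝ)) ^ 2) * (A₀ * (((Lc ^ m : ℕ) : ℝ)) ^ 2)) := by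
          ring
    _ ≤ 2 * (8 * (2 * free.U + 2 * c4 + free.Bgrad)) * ((1 + 80 / kapY (3 + 1)) * (CS 3 * Real.exp (kapY (3 + 1))) * 33 ^ 2 * |A₀| / ((Lc : ℝ) ^ m) ^ 3) := by
          rw [hcast]; exact mul_le_mul_of_nonneg_left hp hAF
    _ = _ := by ring

/-! ## §4 The `ν`-summed gauge-term kernel `Σ_ν ρ_{μνl}` (the `(p,μ),(w,l)` entry of `D·G₀·(1−Π)·Dᵀ·Γ` in this orientation, up to the overall sign) -/

/-- [our object] **`hR0` FOR THE `ν`-SUMMED GAUGE TERM**: `|Σ_ν ρ_{μνl} p w| ≤ 4B₀∕((Lc)^m)²`, one constant for all `m ≥ 1`. -/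
theorem exists_abs_sum_rho_road_le (hLc : Odd Lc ∧ 1 < Lc) :
    ∃ B₀ : ℝ, ∀ m : ℕ, 1 ≤ m → ∀ (μ l : Fin 4) (p w : Pt),
      |∑ ν : Fin 4, ∑' xq : Pt × Pt, (latticeGreen (p - xq.1 + Pi.single μ 1) / 2 - latticeGreen (p - xq.1) / 2)
          * (piC (d := 3) (Lc ^ m) xq.1 (xq.2 + unitVec ν) - piC (d := 3) (Lc ^ m) xq.1 xq.2).re
          * KPerf (d := 3) Lc (sfStep Lc) (smStep 3 Lc) m xq.2 w (Sum.inl ν) (Sum.inl l)|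
        ≤ B₀ / ((Lc : ℝ) ^ m) ^ 2 := by
  obtain ⟨B₀, hB₀⟩ := exists_abs_rho_road_le (Lc := Lc) hLc
  refine ⟨4 * B₀, fun m hm μ l p w => ?_⟩
  calc _ ≤ ∑ ν : Fin 4, |∑' xq : Pt × Pt, (latticeGreen (p - xq.1 + Pi.single μ 1) / 2 - latticeGreen (p - xq.1) / 2)
          * (piC (d := 3) (Lc ^ m) xq.1 (xq.2 + unitVec ν) - piC (d := 3) (Lc ^ m) xq.1 xq.2).re
          * KPerf (d := 3) Lc (sfStep Lc) (smStep 3 Lc) m xq.2 w (Sum.inl ν) (Sum.inl l)| := Finset.abs_sum_le_sum_abs _ _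
    _ ≤ ∑ _ν : Fin 4, B₀ / ((Lc : ℝ) ^ m) ^ 2 := Finset.sum_le_sum fun ν _ => hB₀ m hm μ ν l p w
    _ = 4 * B₀ / ((Lc : ℝ) ^ m) ^ 2 := by rw [Finset.sum_const, Finset.card_univ, Fintype.card_fin]; ring

/-- [our object] **`hR1` FOR THE `ν`-SUMMED GAUGE TERM**: `|Σ_ν (ρ_{μνl} (p+e_i) w − ρ_{μνl} p w)| ≤ 4B₁∕((Lc)^m)³`, one constant for all `m ≥ 1`. -/
theorem exists_abs_sum_rho_road_sub_left_le (hLc : Odd Lc ∧ 1 < Lc) :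
    ∃ B₁ : ℝ, ∀ m : ℕ, 1 ≤ m → ∀ (μ l i : Fin 4) (p w : Pt),
      |∑ ν : Fin 4, ((∑' xq : Pt × Pt, (latticeGreen (p + unitVec i - xq.1 + Pi.single μ 1) / 2 - latticeGreen (p + unitVec i - xq.1) / 2)
            * (piC (d := 3) (Lc ^ m) xq.1 (xq.2 + unitVec ν) - piC (d := 3) (Lc ^ m) xq.1 xq.2).re
            * KPerf (d := 3) Lc (sfStep Lc) (smStep 3 Lc) m xq.2 w (Sum.inl ν) (Sum.inl l))
          - ∑' xq : Pt × Pt, (latticeGreen (p - xq.1 + Pi.single μ 1) / 2 - latticeGreen (p - xq.1) / 2)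
            * (piC (d := 3) (Lc ^ m) xq.1 (xq.2 + unitVec ν) - piC (d := 3) (Lc ^ m) xq.1 xq.2).re
            * KPerf (d := 3) Lc (sfStep Lc) (smStep 3 Lc) m xq.2 w (Sum.inl ν) (Sum.inl l))|
        ≤ B₁ / ((Lc : ℝ) ^ m) ^ 3 := by
  obtain ⟨B₁, hB₁⟩ := exists_abs_rho_road_sub_left_le (Lc := Lc) hLc
  refine ⟨4 * B₁, fun m hm μ l i p w => ?_⟩
  calc _ ≤ ∑ ν : Fin 4, |(∑' xq : Pt × Pt, (latticeGreen (p + unitVec i - xq.1 + Pi.single μ 1) / 2 - latticeGreen (p + unitVec i - xq.1) / 2)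
            * (piC (d := 3) (Lc ^ m) xq.1 (xq.2 + unitVec ν) - piC (d := 3) (Lc ^ m) xq.1 xq.2).re
            * KPerf (d := 3) Lc (sfStep Lc) (smStep 3 Lc) m xq.2 w (Sum.inl ν) (Sum.inl l))
          - ∑' xq : Pt × Pt, (latticeGreen (p - xq.1 + Pi.single μ 1) / 2 - latticeGreen (p - xq.1) / 2)
            * (piC (d := 3) (Lc ^ m) xq.1 (xq.2 + unitVec ν) - piC (d := 3) (Lc ^ m) xq.1 xq.2).re
            * KPerf (d := 3) Lc (sfStep Lc) (smStep 3 Lc) m xq.2 w (Sum.inl ν) (Sum.inl l)| := Finset.abs_sum_le_sum_abs _ _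
    _ ≤ ∑ _ν : Fin 4, B₁ / ((Lc : ℝ) ^ m) ^ 3 := Finset.sum_le_sum fun ν _ => hB₁ m hm μ ν l i p w
    _ = 4 * B₁ / ((Lc : ℝ) ^ m) ^ 3 := by rw [Finset.sum_const, Finset.card_univ, Fintype.card_fin]; ring

end Road

end Summit.QuantumFields.BalabanUV.Beta.FP.GaugeTermRoadLegs

end
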